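import Mathlib
import HarnessLib
import Summits.Ventures.LatticeQCDFlow.Exactness.SphereFlowL1Stability
import Summits.Ventures.LatticeQCDFlow.Exactness.LatticeBoundedDifferences
import Summits.Ventures.LatticeQCDFlow.Exactness.SphereFlowLiouvilleMeasure

/-!
# Concentration of flowed observables for every generator with an `ℓ¹`-modulus: an `ℓ¹`-Lipschitz observable composed with the sphere flow has bounded differences `2L·e^{K|t₁−t₀|}`, variance `≤ |Λ|·L²e^{2K|t₁−t₀|}` and sub-Gaussian exponential moments

HONEST FRAMING: exact (Metropolis-corrected) sampling algorithms for lattice gauge theory;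
figures of merit are autocorrelation/cost numbers at stated couplings and volumes; no
continuum-physics claim.

Venture `LatticeQCDFlow` (cell pub-lqcd), topic `Exactness`; FANOUT row 7 (`s0-cpn-null`).  NEW
WORK of the cell over this leg's `Exactness/SphereFlowL1Stability.lean` (`ℓ¹`-Grönwall: one-site
modifications move the flowed configuration by at most `2e^{K|t₁−t₀|}` in total, for every generator
with an `ℓ¹`-modulus `K`) `Exactness/LatticeBoundedDifferences.lean` (McDiarmid's exponential-moment bound,
Efron–Stein–Popoviciu variance bound) and GEN-15's `Exactness/SphereFlowLiouvilleMeasure.lean` (the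
product of site spheres `Ω`, `π̄`); nothing is cited as a fact.
Printed counterpart, NAMED ONLY: C. McDiarmid 1989 Lemma (1.2).  The E–S leading-order instance
(with `K = 3|κ|υ/(d−1)` and the action, `L = 2|κ|υ`) is `Exactness/SphereLOFlowSelfAveraging.lean`.

## Setting

`π̄ = ⊗_Λ σ̄` on `Ω = S(E)^Λ`; `G : ℝ → (Λ → E) → ℝ` jointly `C²`, horizon `T`, with the `ℓ¹`-MODULUS
`Σ_i‖∂̃_iG_t(x) − ∂̃_iG_t(y)‖ ≤ K·Σ_j‖x_j − y_j‖` on `Ω̃` between `t₀` and `t₁` (`K ≥ 0`); an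
observable `O`, continuous, `ℓ¹`-Lipschitz on `Ω̃` with constant `L`: `|O(x) − O(y)| ≤ L·Σ_j‖x_j − y_j‖`.

## Content

* `continuous_comp_sphereTDFlow_sphereConfig`; **`comp_sphereTDFlow_bddDiff`** — `O∘Φ_{t₀→t₁}` has
  bounded differences `2L·e^{K|t₁−t₀|}` on `Ω` (every site, every volume).
* **`variance_comp_sphereTDFlow_le`** — `Var_π̄(O∘Φ_{t₀→t₁}) ≤ |Λ|·(2Le^{K|t₁−t₀|})²/4`:
  self-averaging of `ℓ¹`-Lipschitz observables under the flowed law of ANY such flow.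
* **`integral_exp_mul_comp_sphereTDFlow_sub_le`** — the sub-Gaussian exponential moments
  `∫e^{u(O∘Φ − E)}dπ̄ ≤ exp(u²|Λ|(2Le^{K|t₁−t₀|})²/8)`.

NOT CLAIMED: how to get `K` for a given generator (E–S LO: `SphereLOFlowL1Stability`); tails in
`measureReal` form (one Chernoff step, `LatticeBoundedDifferencesTails`); numbers.
-/

noncomputable section

namespace Summit.Ventures.LatticeQCDFlow.Exactness

open Function Set Metric MeasureTheory NormedSpace InnerProductSpace
open scoped RealInnerProductSpace Topology

variable {Λ : Type*} {E : Type*} [NormedAddCommGroup E] [InnerProductSpace ℝ E]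
  [FiniteDimensional ℝ E] [Fintype Λ] [DecidableEq Λ] [MeasurableSpace E] [BorelSpace E] [Nontrivial E]
  {G : ℝ → (Λ → E) → ℝ} {T : ℝ}

omit [MeasurableSpace E] [BorelSpace E] [Nontrivial E] in
/-- The flowed observable read on `Ω` is continuous. -/
theorem continuous_comp_sphereTDFlow_sphereConfig (hG : ContDiff ℝ 2 fun q : ℝ × (Λ → E) => G q.1 q.2)
    (t₀ t₁ : ℝ) {O : (Λ → E) → ℝ} (hO : Continuous O) :
    Continuous fun ω : Λ → sphere (0 : E) 1 => O (sphereTDFlow hG T t₀ t₁ (fun m => (ω m : E))) :=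
  hO.comp ((contDiff_sphereTDFlow_apply hG t₀ t₁ (T := T)).continuous.comp continuous_sphereConfig)

omit [MeasurableSpace E] [BorelSpace E] [Nontrivial E] in
/-- **THE FLOWED OBSERVABLE HAS BOUNDED DIFFERENCES `2L·e^{K|t₁−t₀|}`** for every generator with an
`ℓ¹`-modulus `K` between `t₀` and `t₁` and every observable that is `ℓ¹`-Lipschitz with constant `L`
on `Ω̃`. -/
theorem comp_sphereTDFlow_bddDiff (hG : ContDiff ℝ 2 fun q : ℝ × (Λ → E) => G q.1 q.2)
    {K : ℝ} {t₀ t₁ : ℝ}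
    (hmod : ∀ t ∈ uIcc t₀ t₁, ∀ x y : Λ → E, (∀ n, ‖x n‖ = 1) → (∀ n, ‖y n‖ = 1) →
      ∑ i, ‖siteGrad i (G t) x - siteGrad i (G t) y‖ ≤ K * ∑ j, ‖x j - y j‖)
    {O : (Λ → E) → ℝ} {L : ℝ}
    (hOL : ∀ x y : Λ → E, (∀ n, ‖x n‖ = 1) → (∀ n, ‖y n‖ = 1) → |O x - O y| ≤ L * ∑ j, ‖x j - y j‖)
    (ω : Λ → sphere (0 : E) 1) (k : Λ) (v v' : sphere (0 : E) 1) :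
    O (sphereTDFlow hG T t₀ t₁ (fun m => ((update ω k v) m : E))) -
      O (sphereTDFlow hG T t₀ t₁ (fun m => ((update ω k v') m : E))) ≤
      2 * L * Real.exp (K * |t₁ - t₀|) := by
  rw [sphereConfig_update, sphereConfig_update]
  set x : Λ → E := update (fun m => (ω m : E)) k (v : E) with hxdef
  have hx : ∀ n, ‖x n‖ = 1 := by
    intro n
    by_cases hn : n = k
    · subst hn; rw [hxdef, update_self]; exact norm_eq_of_mem_sphere v
    · rw [hxdef, update_of_ne hn]; exact norm_sphereConfig_eq_one ω n
  have hxy : update (fun m => (ω m : E)) k (v' : E) = update x k (v' : E) := by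
    rw [hxdef, update_idem]
  rw [hxy]
  have hy : ∀ n, ‖update x k (v' : E) n‖ = 1 := by
    intro n
    by_cases hn : n = k
    · subst hn; rw [update_self]; exact norm_eq_of_mem_sphere v'
    · rw [update_of_ne hn]; exact hx n
  set Φ : (Λ → E) → (Λ → E) := sphereTDFlow hG T t₀ t₁ with hΦ
  have hΦx : ∀ n, ‖Φ x n‖ = 1 := fun n => norm_sphereTDFlow_eq_one hG t₀ hx t₁ n
  have hΦy : ∀ n, ‖Φ (update x k (v' : E)) n‖ = 1 := fun n => norm_sphereTDFlow_eq_one hG t₀ hy t₁ n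
  have h1 := hOL _ _ hΦx hΦy
  have h2 := sum_norm_sphereTDFlow_update_sub_le_two hG hmod hx k (norm_eq_of_mem_sphere v') (T := T)
  rcases le_or_gt 0 L with hL | hL
  · calc _ ≤ |O (Φ x) - O (Φ (update x k (v' : E)))| := le_abs_self _
      _ ≤ L * ∑ j, ‖Φ x j - Φ (update x k (v' : E)) j‖ := h1
      _ ≤ L * (2 * Real.exp (K * |t₁ - t₀|)) := mul_le_mul_of_nonneg_left h2 hL
      _ = _ := by ring
  · exfalso
    -- flip site `k` of `x`: `Σ_j ‖x_j − x'_j‖ = 2`, contradicting `L < 0`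
    have hneg : ∀ n, ‖update x k (-(x k)) n‖ = 1 := by
      intro n
      by_cases hn : n = k
      · subst hn; rw [update_self, norm_neg]; exact hx n
      · rw [update_of_ne hn]; exact hx n
    have h := hOL x (update x k (-(x k))) hx hneg
    have hsum : ∑ j, ‖x j - update x k (-(x k)) j‖ = 2 := by
      rw [Finset.sum_eq_single k]
      · rw [update_self, sub_neg_eq_add, ← two_smul ℝ (x k), norm_smul, Real.norm_eq_abs,
          abs_two, hx k, mul_one]
      · intro j _ hj; rw [update_of_ne hj, sub_self, norm_zero]
      · intro hk; exact absurd (Finset.mem_univ k) hk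
    rw [hsum] at h
    have : (0 : ℝ) ≤ L * 2 := le_trans (abs_nonneg _) h
    linarith

/-- **SELF-AVERAGING UNDER ANY FLOW WITH AN `ℓ¹`-MODULUS**:
`Var_π̄(O∘Φ_{t₀→t₁}) ≤ |Λ|·(2L·e^{K|t₁−t₀|})²/4` — per site, `Var(O∘Φ/|Λ|) ≤ L²e^{2K|t|}/|Λ|`. -/
theorem variance_comp_sphereTDFlow_le (hG : ContDiff ℝ 2 fun q : ℝ × (Λ → E) => G q.1 q.2)
    {K : ℝ} {t₀ t₁ : ℝ}
    (hmod : ∀ t ∈ uIcc t₀ t₁, ∀ x y : Λ → E, (∀ n, ‖x n‖ = 1) → (∀ n, ‖y n‖ = 1) →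
      ∑ i, ‖siteGrad i (G t) x - siteGrad i (G t) y‖ ≤ K * ∑ j, ‖x j - y j‖)
    {O : (Λ → E) → ℝ} (hO : Continuous O) {L : ℝ}
    (hOL : ∀ x y : Λ → E, (∀ n, ‖x n‖ = 1) → (∀ n, ‖y n‖ = 1) → |O x - O y| ≤ L * ∑ j, ‖x j - y j‖) :
    ∫ ω, (O (sphereTDFlow hG T t₀ t₁ (fun m => ((ω : Λ → sphere (0 : E) 1) m : E))) -
        ∫ ω', O (sphereTDFlow hG T t₀ t₁ (fun m => ((ω' : Λ → sphere (0 : E) 1) m : E)))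
          ∂Measure.pi (fun _ : Λ => uniformSphere (volume : Measure E))) ^ 2
        ∂Measure.pi (fun _ : Λ => uniformSphere (volume : Measure E)) ≤
      Fintype.card Λ * (2 * L * Real.exp (K * |t₁ - t₀|)) ^ 2 / 4 := by
  have h := variance_le_of_bddDiff (uniformSphere (volume : Measure E))
    (continuous_comp_sphereTDFlow_sphereConfig hG t₀ t₁ hO (T := T))
    (D := fun _ : Λ => 2 * L * Real.exp (K * |t₁ - t₀|))
    (fun ω k v v' => comp_sphereTDFlow_bddDiff hG hmod hOL ω k v v')
  simp only [Finset.sum_const, Finset.card_univ, nsmul_eq_mul] at h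
  exact h

/-- **SUB-GAUSSIAN EXPONENTIAL MOMENTS OF A FLOWED OBSERVABLE**: for every real `u`,
`∫ e^{u(O∘Φ_{t₀→t₁} − E)} dπ̄ ≤ exp(u²·|Λ|·(2L·e^{K|t₁−t₀|})²/8)` (McDiarmid). -/
theorem integral_exp_mul_comp_sphereTDFlow_sub_le (hG : ContDiff ℝ 2 fun q : ℝ × (Λ → E) => G q.1 q.2)
    {K : ℝ} {t₀ t₁ : ℝ}
    (hmod : ∀ t ∈ uIcc t₀ t₁, ∀ x y : Λ → E, (∀ n, ‖x n‖ = 1) → (∀ n, ‖y n‖ = 1) →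
      ∑ i, ‖siteGrad i (G t) x - siteGrad i (G t) y‖ ≤ K * ∑ j, ‖x j - y j‖)
    {O : (Λ → E) → ℝ} (hO : Continuous O) {L : ℝ}
    (hOL : ∀ x y : Λ → E, (∀ n, ‖x n‖ = 1) → (∀ n, ‖y n‖ = 1) → |O x - O y| ≤ L * ∑ j, ‖x j - y j‖)
    (u : ℝ) :
    ∫ ω, Real.exp (u * (O (sphereTDFlow hG T t₀ t₁ (fun m => ((ω : Λ → sphere (0 : E) 1) m : E))) -
        ∫ ω', O (sphereTDFlow hG T t₀ t₁ (fun m => ((ω' : Λ → sphere (0 : E) 1) m : E)))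
          ∂Measure.pi (fun _ : Λ => uniformSphere (volume : Measure E))))
        ∂Measure.pi (fun _ : Λ => uniformSphere (volume : Measure E)) ≤
      Real.exp (u ^ 2 * (Fintype.card Λ * (2 * L * Real.exp (K * |t₁ - t₀|)) ^ 2) / 8) := by
  have h := mcdiarmid_integral_exp_le (uniformSphere (volume : Measure E))
    (continuous_comp_sphereTDFlow_sphereConfig hG t₀ t₁ hO (T := T))
    (D := fun _ : Λ => 2 * L * Real.exp (K * |t₁ - t₀|))
    (fun ω k v v' => comp_sphereTDFlow_bddDiff hG hmod hOL ω k v v') u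
  simp only [Finset.sum_const, Finset.card_univ, nsmul_eq_mul] at h
  exact h

end Summit.Ventures.LatticeQCDFlow.Exactness

end
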